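import Mathlib
import Summits.NavierStokesRegularity.NavierStokesRegularity.Theorems.BarrierStepRungThreeCertificateProfileAbove
import HarnessLib

/-!
# Profile kit for window certificates in the repaired format K2″ (route `BarrierStepRungThree`),
  part II: the geometric profile BELOW the window — TAIL RATE and the goal's outside conjunct

Continuation of `BarrierStepRungThreeCertificateProfileAbove.lean` (items
stmt-NavierStokesRegularity-23420 / 23648 / 23942).  BELOW the window (`k < kLo`): geometric caps
`q_k = Q_b G^{kLo-k}`, `r_k = λ q_k`, `ρ_k = (1-λ) q_k / c`.  Proved here:

* `tail_rate_below` — the TAIL RATE clause 26 (`quadTerm_{i,k}(S) S_{i,k} ≤ ρ_k |S_{i,k}|` on REGION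
  states, `k < kLo`) from TWO numeric conditions: `hT1` at the shell `kLo - 1` (upper neighbour = the
  window bottom, energy `≤ E₀`) and `hT2`, which controls all shells `≤ kLo - 2` at once because
  `G 2^{-5/2} ≤ 1`;
* `goal_outside_below` — the outside conjunct of the GOAL clause 27 (`F_{i,1+k}/a² ≤ r_k²/2` for
  `a ≥ 2^{-θ}`) from `2^θ ≤ λ G` and `2^{2θ} 2E₀ ≤ (λ Q_b G)²`.

HONEST FRAMING: bookkeeping for certificates about Tao-type MODEL lattice pseudo-flows (rung TL-M3);
it constructs no certificate, proves nothing about any table, and says nothing about the Navier–Stokes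
equations; no summit is proved by this file.
-/

noncomputable section

-- the sub-problem namespace repeats the summit name by design (D-0017)
set_option linter.dupNamespace false

namespace Summit.NavierStokesRegularity.NavierStokesRegularity.Theorems

namespace CertificateProfile

open scoped BigOperators
open Literature.Analysis.FluidPDE Literature.Analysis.FluidPDE.TaoCascade

/-! ### The geometric profile below the window; TAIL RATE and the goal's outside conjunct -/

section Below

variable {Q_b G : ℝ} {kLo : ℤ} {q : ℤ → ℝ}

/-- Positivity of the lower profile `q_k = Q_b G^{kLo-k}` (`Q_b, G > 0`). [folklore] -/
theorem below_pos (hQb : 0 < Q_b) (hG : 0 < G)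
    (hqb : ∀ k, k < kLo → q k = Q_b * G ^ (kLo - k).toNat) {k : ℤ} (hk : k < kLo) : 0 < q k := by
  rw [hqb k hk]; positivity

/-- The lower profile one shell below the window: `q_{kLo-1} = Q_b G`. [folklore] -/
theorem below_at (hqb : ∀ k, k < kLo → q k = Q_b * G ^ (kLo - k).toNat) :
    q (kLo - 1) = Q_b * G := by
  rw [hqb (kLo - 1) (by omega), show (kLo - (kLo - 1)).toNat = 1 by omega, pow_one]

/-- The lower profile grows by the factor `G` per shell downwards: `q_k = G q_{k+1}` (`k + 1 < kLo`).
[folklore] -/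
theorem below_succ (hqb : ∀ k, k < kLo → q k = Q_b * G ^ (kLo - k).toNat) {k : ℤ}
    (hk : k + 1 < kLo) : q k = G * q (k + 1) := by
  rw [hqb k (by omega), hqb (k + 1) hk, show (kLo - k).toNat = (kLo - (k + 1)).toNat + 1 by omega,
    pow_succ]
  ring

/-- The lower profile `j + 2` shells below the window, `j' = j + 2`: `q_{kLo-2-j} = Q_b G^{j+2}`, and its
neighbours `q_{kLo-1-j} = Q_b G^{j+1}`, `q_{kLo-3-j} = Q_b G^{j+3}`. [folklore] -/
theorem below_at_sub (hqb : ∀ k, k < kLo → q k = Q_b * G ^ (kLo - k).toNat) (j : ℕ) :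
    q (kLo - 2 - j) = Q_b * G ^ (j + 2) ∧ q (kLo - 1 - j) = Q_b * G ^ (j + 1) ∧
      q (kLo - 3 - j) = Q_b * G ^ (j + 3) := by
  refine ⟨?_, ?_, ?_⟩
  · rw [hqb _ (by omega), show (kLo - (kLo - 2 - j)).toNat = j + 2 by omega]
  · rw [hqb _ (by omega), show (kLo - (kLo - 1 - j)).toNat = j + 1 by omega]
  · rw [hqb _ (by omega), show (kLo - (kLo - 3 - j)).toNat = j + 3 by omega]

/-- From the REGION's energy caps to amplitude caps: `S² ≤ 2F ≤ q²` and `q ≥ 0` give `|S| ≤ q`.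
[cite: Tao2016AveragedNS, §4 (4.10) (the energy dominates half the squared amplitude)] -/
theorem abs_le_of_sq_le_two_mul {s f b : ℝ} (h1 : s ^ 2 ≤ 2 * f) (h2 : f ≤ b ^ 2 / 2) (hb : 0 ≤ b) :
    |s| ≤ b := by
  have : s ^ 2 ≤ b ^ 2 := by linarith
  exact abs_le_of_sq_le_sq' this hb |>.elim (fun h h' => abs_le.2 ⟨h, h'⟩)

/-- **TAIL RATE below the window** (clause 26 of the certificate) for the geometric lower profile.
On a REGION state (`S² ≤ 2F`, `F_k ≤ q_k²/2` below the window, `F_{kLo} ≤ E₀` at the window bottom)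
one has `quadTerm_{i,k}(S) · S_{i,k} ≤ ρ_k |S_{i,k}|` for every `k < kLo`, with
`ρ_k = (1-λ) q_k / c`, provided the two numeric tail conditions `hT1` (shell `kLo - 1`, whose upper
neighbour is the window bottom) and `hT2` (all shells `≤ kLo - 2` at once, by `G 2^{-5/2} ≤ 1`) hold.
[cite: Tao2016AveragedNS, §4 (4.8)–(4.9) (the bilinear term and the energy inequality)] -/
theorem tail_rate_below {c lam E₀ A₀ Aₓ A₁ : ℝ} {ρ : ℤ → ℝ}
    (α : Fin 4 → Fin 4 → Fin 4 → ℤ × ℤ × ℤ → ℝ)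
    (hA₀ : ∀ i, (∑ i₁ : Fin 4, ∑ i₂ : Fin 4, |α i₁ i₂ i (0, 0, 0)|) ≤ A₀)
    (hAₓ : ∀ i, (∑ i₁ : Fin 4, ∑ i₂ : Fin 4, |α i₁ i₂ i (1, 0, 0)|) +
      (∑ i₁ : Fin 4, ∑ i₂ : Fin 4, |α i₁ i₂ i (0, 1, 0)|) ≤ Aₓ)
    (hA₁ : ∀ i, (∑ i₁ : Fin 4, ∑ i₂ : Fin 4, |α i₁ i₂ i (0, 0, 1)|) ≤ A₁)
    (hc : 0 < c) (hQb : 0 < Q_b) (hG : 0 < G) (hu : G * (2 : ℝ) ^ (-(5 : ℝ) / 2) ≤ 1)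
    (hqb : ∀ k, k < kLo → q k = Q_b * G ^ (kLo - k).toNat)
    (hρ : ∀ k, k < kLo → ρ k = (1 - lam) * q k / c)
    (hT1 : c * ((2 : ℝ) ^ ((5 : ℝ) * ((kLo - 1 : ℤ) : ℝ) / 2) *
        (A₀ * (Q_b * G) ^ 2 + Aₓ * (Q_b * G) * Real.sqrt (2 * E₀)) +
        (2 : ℝ) ^ ((5 : ℝ) * ((kLo - 2 : ℤ) : ℝ) / 2) * (A₁ * (Q_b * G ^ 2) ^ 2)) ≤
        (1 - lam) * (Q_b * G))
    (hT2 : c * Q_b * (2 : ℝ) ^ ((5 : ℝ) * (kLo : ℝ) / 2) * (G * (2 : ℝ) ^ (-(5 : ℝ) / 2)) ^ 2 *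
        (A₀ + Aₓ / G + A₁ * G ^ 2 * (2 : ℝ) ^ (-(5 : ℝ) / 2)) ≤ 1 - lam)
    (S F : Fin 4 → ℤ → ℝ) (hSF : ∀ i k, S i k ^ 2 ≤ 2 * F i k)
    (hFout : ∀ i k, k < kLo → F i k ≤ q k ^ 2 / 2) (hF0 : ∀ i, F i kLo ≤ E₀) :
    ∀ (i : Fin 4) (k : ℤ), k < kLo →
      quadTerm 1 α (fun i' k' (_ : ℝ) => S i' k') i k 0 * S i k ≤ ρ k * |S i k| := by
  intro i k hk
  -- amplitude caps from the energy caps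
  have hcap : ∀ j k', k' < kLo → |S j k'| ≤ q k' := fun j k' hk' =>
    abs_le_of_sq_le_two_mul (hSF j k') (hFout j k' hk') (below_pos hQb hG hqb hk').le
  have hcap0 : ∀ j, |S j kLo| ≤ Real.sqrt (2 * E₀) := fun j => by
    refine Real.abs_le_sqrt ?_
    linarith [hSF j kLo, hF0 j]
  have h2 : (0 : ℝ) < 1 + 1 := by norm_num
  have hA₀0 : 0 ≤ A₀ := le_trans (by positivity) (hA₀ i)
  have hAₓ0 : 0 ≤ Aₓ := le_trans (by positivity) (hAₓ i)
  have hA₁0 : 0 ≤ A₁ := le_trans (by positivity) (hA₁ i)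
  -- it suffices to bound |quadTerm| by ρ k
  suffices hB : |quadTerm 1 α (fun i' k' (_ : ℝ) => S i' k') i k 0| ≤ ρ k by
    calc quadTerm 1 α (fun i' k' (_ : ℝ) => S i' k') i k 0 * S i k
        ≤ |quadTerm 1 α (fun i' k' (_ : ℝ) => S i' k') i k 0 * S i k| := le_abs_self _
      _ = |quadTerm 1 α (fun i' k' (_ : ℝ) => S i' k') i k 0| * |S i k| := abs_mul _ _
      _ ≤ ρ k * |S i k| := mul_le_mul_of_nonneg_right hB (abs_nonneg _)
  -- generic weighted three-shell bound with caps a (shell k-1), b (shell k), d (shell k+1)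
  have hgen : ∀ {a b d : ℝ}, 0 ≤ a → 0 ≤ b → 0 ≤ d → (∀ j, |S j (k - 1)| ≤ a) →
      (∀ j, |S j k| ≤ b) → (∀ j, |S j (k + 1)| ≤ d) →
      |quadTerm 1 α (fun i' k' (_ : ℝ) => S i' k') i k 0| ≤
        (2 : ℝ) ^ ((5 : ℝ) * k / 2) * (A₀ * (b * b) + Aₓ * (b * d)) +
          (2 : ℝ) ^ ((5 : ℝ) * (k - 1 : ℤ) / 2) * (A₁ * (a * a)) := by
    intro a b d ha0 hb0 hd0 ha hb hd
    have h := abs_quadTerm_le_three_shell_weighted h2 α (fun i' k' (_ : ℝ) => S i' k') i k 0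
      ha0 hb0 hd0 ha hb hd
    rw [show (1 + 1 : ℝ) = 2 by norm_num] at h
    refine h.trans ?_
    have hw1 : 0 ≤ (2 : ℝ) ^ ((5 : ℝ) * k / 2) := (Real.rpow_pos_of_pos (by norm_num) _).le
    have hw2 : 0 ≤ (2 : ℝ) ^ ((5 : ℝ) * (k - 1 : ℤ) / 2) := (Real.rpow_pos_of_pos (by norm_num) _).le
    gcongr
    · exact hA₀ i
    · exact hAₓ i
    · exact hA₁ i
  rcases lt_or_eq_of_le (show k ≤ kLo - 1 by omega) with hk2 | hk1
  · -- shells k ≤ kLo - 2: write k = kLo - 2 - j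
    obtain ⟨j, hj⟩ : ∃ j : ℕ, k = kLo - 2 - j := ⟨(kLo - 2 - k).toNat, by omega⟩
    obtain ⟨hqk, hqk1, hqk3⟩ := below_at_sub hqb j
    have hb := hgen (a := Q_b * G ^ (j + 3)) (b := Q_b * G ^ (j + 2)) (d := Q_b * G ^ (j + 1))
      (by positivity) (by positivity) (by positivity)
      (fun j' => by rw [← hqk3, show kLo - 3 - j = k - 1 by omega]; exact hcap j' _ (by omega))
      (fun j' => by rw [← hqk, ← hj]; exact hcap j' _ hk)
      (fun j' => by rw [← hqk1, show kLo - 1 - j = k + 1 by omega]; exact hcap j' _ (by omega))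
    refine hb.trans ?_
    rw [hρ k hk, hj, hqk]
    -- the rescaling identities
    set w : ℝ := (2 : ℝ) ^ (-(5 : ℝ) / 2) with hw
    set R : ℝ := (2 : ℝ) ^ ((5 : ℝ) * (kLo : ℝ) / 2) with hR
    have hw0 : 0 < w := Real.rpow_pos_of_pos (by norm_num) _
    have hR0 : 0 < R := Real.rpow_pos_of_pos (by norm_num) _
    have e1 : (2 : ℝ) ^ ((5 : ℝ) * ((kLo - 2 - j : ℤ) : ℝ) / 2) = R * w ^ (j + 2) := by
      rw [hR, hw, two_rpow_pow, ← two_rpow_add]; congr 1; push_cast; ring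
    have e2 : (2 : ℝ) ^ ((5 : ℝ) * ((kLo - 2 - j : ℤ) - 1 : ℤ) / 2) = R * w ^ (j + 3) := by
      rw [hR, hw, two_rpow_pow, ← two_rpow_add]; congr 1; push_cast; ring
    rw [e1, e2]
    have hGw : (G * w) ^ (j + 2) ≤ (G * w) ^ 2 :=
      pow_le_pow_of_le_one (by positivity) hu (by omega)
    have hbr : 0 ≤ A₀ + Aₓ / G + A₁ * G ^ 2 * w := by positivity
    -- B = Q_b G^{j+2} · [Q_b R (Gw)^{j+2} (A₀ + Aₓ/G + A₁ G² w)]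
    have hid : R * w ^ (j + 2) * (A₀ * (Q_b * G ^ (j + 2) * (Q_b * G ^ (j + 2))) +
          Aₓ * (Q_b * G ^ (j + 2) * (Q_b * G ^ (j + 1)))) +
        R * w ^ (j + 3) * (A₁ * (Q_b * G ^ (j + 3) * (Q_b * G ^ (j + 3)))) =
        Q_b * G ^ (j + 2) * (Q_b * R * (G * w) ^ (j + 2) * (A₀ + Aₓ / G + A₁ * G ^ 2 * w)) := by
      field_simp
      ring
    rw [hid]
    have hT2' : Q_b * R * (G * w) ^ (j + 2) * (A₀ + Aₓ / G + A₁ * G ^ 2 * w) ≤ (1 - lam) / c := by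
      rw [le_div_iff₀ hc]
      calc Q_b * R * (G * w) ^ (j + 2) * (A₀ + Aₓ / G + A₁ * G ^ 2 * w) * c
          ≤ Q_b * R * (G * w) ^ 2 * (A₀ + Aₓ / G + A₁ * G ^ 2 * w) * c := by
            gcongr
        _ = c * Q_b * R * (G * w) ^ 2 * (A₀ + Aₓ / G + A₁ * G ^ 2 * w) := by ring
        _ ≤ 1 - lam := hT2
    calc Q_b * G ^ (j + 2) * (Q_b * R * (G * w) ^ (j + 2) * (A₀ + Aₓ / G + A₁ * G ^ 2 * w))
        ≤ Q_b * G ^ (j + 2) * ((1 - lam) / c) := mul_le_mul_of_nonneg_left hT2' (by positivity)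
      _ = (1 - lam) * (Q_b * G ^ (j + 2)) / c := by ring
  · -- the shell k = kLo - 1, whose upper neighbour is the window bottom
    have hq1 : q (kLo - 1) = Q_b * G := below_at hqb
    have hq2 : q (kLo - 2) = Q_b * G ^ 2 := by
      rw [hqb _ (by omega), show (kLo - (kLo - 2)).toNat = 2 by omega]
    have hb := hgen (a := Q_b * G ^ 2) (b := Q_b * G) (d := Real.sqrt (2 * E₀))
      (by positivity) (by positivity) (Real.sqrt_nonneg _)
      (fun j' => by rw [← hq2, show kLo - 2 = k - 1 by omega]; exact hcap j' _ (by omega))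
      (fun j' => by rw [← hq1, ← hk1]; exact hcap j' _ hk)
      (fun j' => by rw [show k + 1 = kLo by omega]; exact hcap0 j')
    refine hb.trans ?_
    rw [hρ k hk, hk1, hq1, le_div_iff₀ hc]
    have e : ((5 : ℝ) * ((kLo - 1 : ℤ) : ℝ) / 2) = (5 : ℝ) * ((kLo - 1 : ℤ) : ℝ) / 2 := rfl
    have := hT1
    rw [show ((kLo - 1 : ℤ) - 1 : ℤ) = kLo - 2 by ring]
    nlinarith [hT1]

/-- **The goal's outside conjunct below the window** (last conjunct of clause 27) for the geometric
lower profile: at a REGION state with `|S_{i₀,1}| =: a ≥ 2^{-θ}`, the shifted rescaled energies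
below the window re-enter the caps `r_k²/2`: `F_{i,1+k}/a² ≤ r_k²/2` for `k < kLo`, because
`r_k = λ q_k = λ G q_{k+1} ≥ 2^θ q_{k+1}` and, at the window bottom, `2^{2θ} · 2E₀ ≤ (λ Q_b G)²`.
[cite: Tao2016AveragedNS, §6.2 Prop. 6.3 (vi)–(ix) (re-entry after rescaling by the ratio
`≥ (1+ε₀)^{-θ}`)] -/
theorem goal_outside_below {θ lam E₀ : ℝ} {r : ℤ → ℝ} (hQb : 0 < Q_b) (hG : 0 < G)
    (hE₀ : 0 ≤ E₀) (hqb : ∀ k, k < kLo → q k = Q_b * G ^ (kLo - k).toNat)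
    (hr : ∀ k, k < kLo → r k = lam * q k) (hlamG : (2 : ℝ) ^ θ ≤ lam * G)
    (hgoal0 : (2 : ℝ) ^ (2 * θ) * (2 * E₀) ≤ (lam * Q_b * G) ^ 2)
    (F : Fin 4 → ℤ → ℝ) (hFout : ∀ i k, k < kLo → F i k ≤ q k ^ 2 / 2) (hF0 : ∀ i, F i kLo ≤ E₀)
    {a : ℝ} (ha : (1 + 1 : ℝ) ^ (-θ) ≤ a) :
    ∀ (i : Fin 4) (k : ℤ), k < kLo → F i (1 + k) / a ^ 2 ≤ r k ^ 2 / 2 := by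
  intro i k hk
  rw [show (1 + 1 : ℝ) = 2 by norm_num] at ha
  have h2θ : (0 : ℝ) < (2 : ℝ) ^ (-θ) := Real.rpow_pos_of_pos (by norm_num) _
  have ha0 : 0 < a := lt_of_lt_of_le h2θ ha
  have hsq : (2 : ℝ) ^ (2 * θ) = ((2 : ℝ) ^ θ) ^ 2 := by
    rw [show (2 : ℝ) * θ = θ + θ by ring, two_rpow_add, sq]
  -- 1/a² ≤ 2^{2θ}
  have hinv : 1 / a ^ 2 ≤ (2 : ℝ) ^ (2 * θ) := by
    rw [div_le_iff₀ (by positivity), hsq]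
    have hprod : (1 : ℝ) ≤ (2 : ℝ) ^ θ * a := by
      calc (1 : ℝ) = (2 : ℝ) ^ θ * (2 : ℝ) ^ (-θ) := by
            rw [← two_rpow_add, add_neg_cancel, Real.rpow_zero]
        _ ≤ (2 : ℝ) ^ θ * a :=
            mul_le_mul_of_nonneg_left ha (Real.rpow_pos_of_pos (by norm_num) _).le
    nlinarith [Real.rpow_pos_of_pos (show (0 : ℝ) < 2 by norm_num) θ]
  have h2θ0 : 0 ≤ (2 : ℝ) ^ (2 * θ) := (Real.rpow_pos_of_pos (by norm_num) _).le
  rcases lt_or_eq_of_le (show 1 + k ≤ kLo by omega) with hlt | heq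
  · -- 1 + k < kLo: both shells below the window
    have hF := hFout i (1 + k) hlt
    have hq0 : 0 ≤ q (1 + k) := (below_pos hQb hG hqb hlt).le
    have hrk : r k = lam * G * q (1 + k) := by
      rw [hr k hk, below_succ hqb (show k + 1 < kLo by omega), show k + 1 = 1 + k by ring]; ring
    calc F i (1 + k) / a ^ 2 = F i (1 + k) * (1 / a ^ 2) := by ring
      _ ≤ (q (1 + k) ^ 2 / 2) * (2 : ℝ) ^ (2 * θ) :=
          mul_le_mul hF hinv (by positivity) (by positivity)
      _ = ((2 : ℝ) ^ θ * q (1 + k)) ^ 2 / 2 := by rw [hsq]; ring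
      _ ≤ (lam * G * q (1 + k)) ^ 2 / 2 := by
          have h1 : (2 : ℝ) ^ θ * q (1 + k) ≤ lam * G * q (1 + k) :=
            mul_le_mul_of_nonneg_right hlamG hq0
          have h0 : 0 ≤ (2 : ℝ) ^ θ * q (1 + k) :=
            mul_nonneg (Real.rpow_pos_of_pos (by norm_num) _).le hq0
          have := pow_le_pow_left₀ h0 h1 2
          linarith
      _ = r k ^ 2 / 2 := by rw [hrk]
  · -- 1 + k = kLo: the window bottom
    rw [heq]
    have hrk : r k = lam * Q_b * G := by
      rw [hr k hk, show k = kLo - 1 by omega, below_at hqb]; ring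
    have hF := hF0 i
    calc F i kLo / a ^ 2 = F i kLo * (1 / a ^ 2) := by ring
      _ ≤ E₀ * (2 : ℝ) ^ (2 * θ) := by
          have hEpos : F i kLo * (1 / a ^ 2) ≤ E₀ * (1 / a ^ 2) :=
            mul_le_mul_of_nonneg_right hF (by positivity)
          exact hEpos.trans (mul_le_mul_of_nonneg_left hinv hE₀)
      _ ≤ (lam * Q_b * G) ^ 2 / 2 := by linarith
      _ = r k ^ 2 / 2 := by rw [hrk]

end Below

end CertificateProfile

end Summit.NavierStokesRegularity.NavierStokesRegularity.Theorems

end
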